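import Summits.QuantumFields.BalabanUV.T4Continuum.Support.NE3LinearisedAverageLocality
import HarnessLib

/-!
# NE7QbarLocality — LOCALITY OF THE k-FOLD LINEARISED DOUBLE-BAR AVERAGE `Q̄^{(k)}_W Z`, jointly in the background `W` and the direction `Z`: `QbarIter L k W Z z κ`
# depends on `(W, Z)` only through the bonds of `B^k(c₋) ∪ B^k(c₊) = [loK L k z, bondHiK L k z κ]`, `c = (z, κ)` — row NE3's `NE3LinearisedAverageLocality` (which did
# `cpush ∕ dirIter ∕ relIter`) completed for the frame-corrected average `Qbar = dbarLin(L•)` (the linearised frames `frameLin` at the two block corners are local too: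
# their tree words stay in the block)

Cell `pub-balaban`, rung (B)+1 sub-cell t4, lineage `b2b-balaban-t4-ne7-p1` (CRUX PROVER NE7 #1 = OWNER of row NE7), generation 89; memo
`t4/b2b-balaban-t4-ne7-p1-g89/COSTING-N1.md` §7 ((N2)-straight, brick B3).  File F265 (over row NE3's `NE3LinearisedAverageLocality` (`pushDir_congr₂`, `agreeOn_vary`, the box
lemmas `inBox_corner ∕ inBox_far_corner ∕ inBox_blockPoint ∕ inBox_blockPoint_far ∕ agreeOn_blockPair_of_succ ∕ cavg_agreeOn_of_succ ∕ eq_of_agreeOn_level_zero`), lit-balaban's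
`B7Prop1Local` (`hol_treeWord_congr`, `bavg_congr`), `AveragingDeficitTransport.hasDerivAt_val_hol_vary_word`).

WHY (memo §7).  The v4 defect assembly pairs `dAction_{U′}(χ′Y)` through criticality of the gauge-fixed configuration `U′` and bounds it by `c_R·‖Q̄_{U′}(χ′Y)‖₁` (F264);
the Lipschitz budget F51 (`‖(Q̄_{e^A} − Q̄_1)Z‖₁ ≤ C·Mα₀·M^{1−d}‖Z‖₁`) is stated for a background that is GLOBALLY `e^{A}`, while `U′ = e^{A}` only on the chart's cube.
Locality closes the gap: `Q̄_{U′}(χ′Y)(w,τ) = Q̄_{e^A}(χ′Y)(w,τ)` whenever the two backgrounds and the direction agree on the level box of `(w,τ)`.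
WHAT ([folklore] kinematic bookkeeping; 0 def, 0 sorry; generic `d`).
§1 `dhol_treeWord_congr₂`, `frameLin_congr₂`, `dbarLin_congr₂`, `Qbar_congr₂` (one step, box `[L•z, bondHi L (L•z) κ]`).
§2 `Qbar_agreeOn_of_succ`, **`QbarIter_congr₂`** (`AgreeOn (loK L k z) (bondHiK L k z κ) W W′ → AgreeOn … Z Z′ → QbarIter L k W Z z κ = QbarIter L k W′ Z′ z κ`),
   `QbarIter_congr` (direction only).
§3 `bounds_of_inBox_level` (a site of the level-`k` box has `L^k z_i ≤ x_i ≤ L^k z_i + 2L^k − 1`), `agreeOn_level_of_slab` (agreement on that slab ⇒ `AgreeOn`).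
HONEST FRAMING (page 1): kinematics of the averaging map on OUR objects; nothing of Bałaban's asserted ([B7] p. 24's locality sentence is the TEXT LOCATION); NOT (APE),
NOT ONE-STEP, NOT NE7; spine 0∕9; finite T⁴ rung (B)+1 — NOT infinite volume, NOT mass gap, NOT `BetaPertH`, NOT Clay.  Continuum YM on T⁴ ⇐ BetaPertH ∧ nine spine
estimates (0/9 proved); BetaPertH ⇐ (D1) ∧ (D4) ∧ CAP+tail; G-an2-4 gates asym, D1 and NE2/3/4.
-/

set_option autoImplicit false

open scoped BigOperators Matrix.Norms.L2Operator
open NormedSpace Finset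

namespace Summit.QuantumFields.BalabanUV.T4Continuum.NE7QbarLocality

open Literature.MathematicalPhysics.QuantumFieldTheory.Balaban1983to89
open B7Prop1Explicit B7Prop2Explicit MatrixLog
open B7Prop1Local (InBox AgreeOn bondHi loK bondHiK bavg_congr hol_treeWord_congr add_zsmul_e_apply add_e_apply)
open T4AveragingDeficitWall (IsSkewDir vary Ad)
open AveragingDeficitChartCalculus (cavg)
open AveragingDeficitTransport (dhol hasDerivAt_val_hol_vary_word)
open BlockAveragePushDirSplit (frameLin dbarLin)
open NE3TangentCovariantStructure (Qbar)
open NE3TangentCovariantTower (QbarIter QbarIter_succ QbarIter_zero)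
open NE3LinearisedAverageLocality (agreeOn_self agreeOn_vary inBox_corner inBox_far_corner inBox_blockPoint inBox_blockPoint_far pushDir_congr₂
  agreeOn_blockPair_of_succ cavg_agreeOn_of_succ eq_of_agreeOn_level_zero)

noncomputable section

variable {d : ℕ} {n : Type*} [Fintype n] [DecidableEq n]

/-! ## §1 One step: the linearised frames and the double-bar average -/

section OneStep

/-- The linearised transport `(δ_ψV)(Γ_{p,p+v})` along a tree word agrees for data agreeing on a box containing `p` and `p + v` — by uniqueness of the derivative of
`s ↦ V_s(Γ)`, which agrees for all `s` (`hol_treeWord_congr`). [cite: Balaban1985Averaging, p.24 (sentence after (43))] -/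
theorem dhol_treeWord_congr₂ {lo hi : Site d} {V V' : Site d → Fin d → (Matrix n n ℂ)ˣ} {ψ ψ' : Site d → Fin d → Matrix n n ℂ}
    (hV : AgreeOn lo hi V V') (hψ : AgreeOn lo hi ψ ψ') (p v : Site d) (hp : InBox lo hi p) (hpv : InBox lo hi (p + v)) :
    dhol V ψ p (treeWord v) = dhol V' ψ' p (treeWord v) := by
  have h1 := hasDerivAt_val_hol_vary_word V ψ (treeWord v) p
  have h2 := hasDerivAt_val_hol_vary_word V' ψ' (treeWord v) p
  have e1 : (fun s : ℝ => ((hol (vary V ψ s) p (treeWord v) : (Matrix n n ℂ)ˣ) : Matrix n n ℂ))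
      = fun s : ℝ => ((hol (vary V' ψ' s) p (treeWord v) : (Matrix n n ℂ)ˣ) : Matrix n n ℂ) :=
    funext fun s => by rw [hol_treeWord_congr (agreeOn_vary hV hψ s) p v hp hpv]
  rw [e1] at h1
  have h := h1.unique h2
  rw [hol_treeWord_congr hV p v hp hpv] at h
  exact (Units.mul_left_inj _).mp h

/-- The linearised block frame `frameLin L V ψ p = Σ_r L^{−d}(δ_ψV)(Γ_{p,p+r})` agrees for data agreeing on a box containing the block `p + [0,L)^d`. [folklore] -/
theorem frameLin_congr₂ {lo hi : Site d} {V V' : Site d → Fin d → (Matrix n n ℂ)ˣ} {ψ ψ' : Site d → Fin d → Matrix n n ℂ}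
    (hV : AgreeOn lo hi V V') (hψ : AgreeOn lo hi ψ ψ') (L : ℕ) (p : Site d) (hp : InBox lo hi p)
    (hpr : ∀ r : Fin d → Fin L, InBox lo hi (p + boxVec L r)) : frameLin L V ψ p = frameLin L V' ψ' p := by
  unfold frameLin
  exact Finset.sum_congr rfl fun r _ => by rw [dhol_treeWord_congr₂ hV hψ p (boxVec L r) hp (hpr r)]

/-- **LOCALITY OF THE LINEARISED DOUBLE-BAR AVERAGE (one step), jointly**: `dbarLin L V ψ q κ` depends on `(V, ψ)` only through the bonds of `B(c₋) ∪ B(c₊) =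
[q, bondHi L q κ]` (the push-forward by row NE3, the two frames by their tree words inside the two blocks). [cite: Balaban1985Averaging, p.24 (sentence after (43))] -/
theorem dbarLin_congr₂ {L : ℕ} (hL : 1 ≤ L) {V V' : Site d → Fin d → (Matrix n n ℂ)ˣ} {ψ ψ' : Site d → Fin d → Matrix n n ℂ} {q : Site d} {κ : Fin d}
    (hV : AgreeOn q (bondHi L q κ) V V') (hψ : AgreeOn q (bondHi L q κ) ψ ψ') : dbarLin L V ψ q κ = dbarLin L V' ψ' q κ := by
  unfold dbarLin
  rw [pushDir_congr₂ hL hV hψ, bavg_congr L hL q κ hV,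
    frameLin_congr₂ hV hψ L q (inBox_corner hL q κ) (fun r => inBox_blockPoint L q κ r),
    frameLin_congr₂ hV hψ L (q + (L : ℤ) • e κ) (inBox_far_corner hL q κ)
      (fun r => by rw [add_right_comm]; exact inBox_blockPoint_far L q κ r)]

/-- **LOCALITY OF `Qbar` (one step on the unit lattice), jointly**: `Qbar L W X z κ` depends on `(W, X)` only through the bonds of `[L•z, bondHi L (L•z) κ]`.
[cite: Balaban1985Averaging, p.24 (sentence after (43))] -/
theorem Qbar_congr₂ {L : ℕ} (hL : 1 ≤ L) {W W' : Site d → Fin d → (Matrix n n ℂ)ˣ} {X X' : Site d → Fin d → Matrix n n ℂ} (z : Site d) (κ : Fin d)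
    (hW : AgreeOn ((L : ℤ) • z) (bondHi L ((L : ℤ) • z) κ) W W') (hX : AgreeOn ((L : ℤ) • z) (bondHi L ((L : ℤ) • z) κ) X X') :
    Qbar L W X z κ = Qbar L W' X' z κ := by
  show dbarLin L W X ((L : ℤ) • z) κ = dbarLin L W' X' ((L : ℤ) • z) κ
  exact dbarLin_congr₂ hL hW hX

end OneStep

/-! ## §2 The tower -/

/-- One double-bar step maps agreement on the level-`(k+1)` box to agreement of the averaged directions on the level-`k` box. [folklore] -/
theorem Qbar_agreeOn_of_succ {L : ℕ} (hL : 1 ≤ L) (k : ℕ) (z : Site d) (κ : Fin d) {W W' : Site d → Fin d → (Matrix n n ℂ)ˣ}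
    {X X' : Site d → Fin d → Matrix n n ℂ} (hW : AgreeOn (loK L (k + 1) z) (bondHiK L (k + 1) z κ) W W')
    (hX : AgreeOn (loK L (k + 1) z) (bondHiK L (k + 1) z κ) X X') :
    AgreeOn (loK L k z) (bondHiK L k z κ) (Qbar L W X) (Qbar L W' X') := fun _ μ hy hye =>
  Qbar_congr₂ hL _ μ (agreeOn_blockPair_of_succ hL k z κ hW hy hye) (agreeOn_blockPair_of_succ hL k z κ hX hy hye)

/-- **LOCALITY OF THE k-FOLD LINEARISED DOUBLE-BAR AVERAGE, jointly**: `QbarIter L k W X z κ` depends on the background `W` and on the direction `X` only through their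
values on the bonds of `B^k(c₋) ∪ B^k(c₊) = [loK L k z, bondHiK L k z κ]`, `c = (z, κ)` — by row NE3's induction (`cavg_agreeOn_of_succ` for the backgrounds, §1 for the
directions). [cite: Balaban1985Averaging, p.24 (sentence after (43))] -/
theorem QbarIter_congr₂ {L : ℕ} (hL : 1 ≤ L) :
    ∀ (k : ℕ) {W W' : Site d → Fin d → (Matrix n n ℂ)ˣ} {X X' : Site d → Fin d → Matrix n n ℂ} (z : Site d) (κ : Fin d),
      AgreeOn (loK L k z) (bondHiK L k z κ) W W' → AgreeOn (loK L k z) (bondHiK L k z κ) X X' →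
        QbarIter L k W X z κ = QbarIter L k W' X' z κ
  | 0, _, _, _, _, z, κ, _, hX => by
    rw [QbarIter_zero, QbarIter_zero]
    exact eq_of_agreeOn_level_zero L z κ hX
  | k + 1, _, _, _, _, z, κ, hW, hX => by
    rw [QbarIter_succ, QbarIter_succ]
    exact QbarIter_congr₂ hL k z κ (cavg_agreeOn_of_succ hL k z κ hW) (Qbar_agreeOn_of_succ hL k z κ hW hX)

/-- **Π-C-3♭ FOR `QbarIter`** (direction only, background fixed). [cite: Balaban1985Averaging, p.24 (sentence after (43))] -/
theorem QbarIter_congr {L : ℕ} (hL : 1 ≤ L) (k : ℕ) (W : Site d → Fin d → (Matrix n n ℂ)ˣ) {X X' : Site d → Fin d → Matrix n n ℂ} (z : Site d) (κ : Fin d)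
    (hX : AgreeOn (loK L k z) (bondHiK L k z κ) X X') : QbarIter L k W X z κ = QbarIter L k W X' z κ :=
  QbarIter_congr₂ hL k z κ (agreeOn_self _ _ W) hX

/-! ## §3 The level box in block coordinates -/

section Slab

variable {G : Type*}

omit [Fintype n] [DecidableEq n] in
/-- A site of the level-`k` box of `(z, κ)` lies in the slab `L^k z_i ≤ x_i ≤ L^k z_i + 2L^k − 1`. [folklore] -/
theorem bounds_of_inBox_level (L k : ℕ) (z : Site d) (κ : Fin d) {x : Site d} (hx : InBox (loK L k z) (bondHiK L k z κ) x) (i : Fin d) :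
    (L : ℤ) ^ k * z i ≤ x i ∧ x i ≤ (L : ℤ) ^ k * z i + 2 * (L : ℤ) ^ k - 1 := by
  have h := hx i
  have hP : (0 : ℤ) ≤ (L : ℤ) ^ k := by positivity
  simp only [loK, bondHiK] at h
  constructor
  · exact h.1
  · split_ifs at h <;> omega

omit [Fintype n] [DecidableEq n] in
/-- Fields agreeing on every bond whose base point lies in the slab `L^k z_i ≤ x_i ≤ L^k z_i + 2L^k − 1` agree on the level-`k` box of `(z, κ)`. [folklore] -/
theorem agreeOn_level_of_slab (L k : ℕ) (z : Site d) (κ : Fin d) {F F' : Site d → Fin d → G}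
    (h : ∀ (x : Site d) (μ : Fin d), (∀ i, (L : ℤ) ^ k * z i ≤ x i ∧ x i ≤ (L : ℤ) ^ k * z i + 2 * (L : ℤ) ^ k - 1) → F x μ = F' x μ) :
    AgreeOn (loK L k z) (bondHiK L k z κ) F F' := fun x μ hx _ =>
  h x μ (bounds_of_inBox_level L k z κ hx)

end Slab

end

end Summit.QuantumFields.BalabanUV.T4Continuum.NE7QbarLocality
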